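/-
Copyright: statement-level skeleton of a published paper (lit-balaban cell, Phase-2 proof seat p25, gen 18). No proof
claims beyond what the kernel checks below.
-/
import Literature.MathematicalPhysics.QuantumFieldTheory.BalabanImbrieJaffe1984to88.BIJ88WalkResummation312
import Literature.MathematicalPhysics.QuantumFieldTheory.BalabanImbrieJaffe1984to88.BIJ88WalkActivityShape312

/-!
# `BalabanImbrieJaffe1984to88.BIJ88WalkLabelPartition312` — T. Bałaban, J. Imbrie, A. Jaffe, *Effective action and
cluster properties of the abelian Higgs model*, Commun. Math. Phys. **114** (1988) 257–315 [BalabanImbrieJaffe1988],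
§5.14 p. 311–312 [PDF 55–56], verbatim: *"⟨Π_i F_{k,loc}(X_{σ_i})⟩ = Σ_{{X_r}} Π_c F^L_{k+1,loc}(X_c) ⟨Π_r F_{k,rem}(X_r)⟩.
We can arrange the construction so that the {X_c} are determined once the remainder components are specified."* (DOCFIX
p25 gen 19, r16 v2.249 / ref-5 D-g64-2 class: the gen-18 header shortened this sentence inside quotation marks; the
printed sentence is restored, declarations untouched) — **THE OBSERVABLES ARE PARTITIONED AMONG THE
BLOCKS AND THE REMAINDER COMPONENTS OF EVERY TERM** (p25 gen 18): along the covariance-split expansion the label sets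
of the constant components (blocks) and of the components set aside are PAIRWISE DISJOINT (`expand_labDisj`) — with
`BIJ88WalkResummation312.expand_lab` (their union is all the observables) every term's components carry a set
partition of the observables.  This is the bookkeeping that turns `Π_{X} Π_{j ∈ X.lab} c_j` into `Π_{j} c_j` in the
printed currency (the exported form of what `BIJ88WalkActivityShape312.expand_tidy` threads internally).

statement-level skeleton of published theorems with citation tags; proofs where landed; nothing here is a claim
about the Yang–Mills mass gap

PDF held: `paper:balaban1988-cmp114-bij-abelian-higgs-effective-action` (journal page = PDF page + 256); p. 311–312 =
PDF 55–56 (`p0055.txt` L23–38, `p0056.txt` L1–25 re-read 2026-08-22; `p0056.txt` L2–3 re-read for the docfix,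
2026-08-23).

CITATION HEADER (lean-in-tree rule).  lit-balaban cell (HOME `run/shared/lean/pub/lit-balaban/`), Phase 2, seat p25
gen 18; row **C2.Claim@312** of `HOME/lit-balaban-r16/ROWS-C2-part2.md` (owner r16, referee ref-5; head
`BIJ88Sect5StatementsPart4.Ineq312` untouched — MEMBER of the row).  USED BY NAME, nothing restated:
`BIJ88WalkResummation312.expand_lab`, `BIJ88WalkActivityShape312.{EnvOK, envOK_zero}`, `BIJ88WalkWeights312.{LabDisj,
labDisj_pristine, run_labDisj, run_tidy, tidy_pristine}`, `BIJ88WalkExpansion311`, `BIJ88WalkRunEnv311.run_rest_subset`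
(this seat and generation), `BIJ88LabelledRun311.mem_mbind`.

## What is proved (0 `sorry`, standard axioms, no new `Prop` facts; theorems only)

* **`expand_labDisj`**, `expand_labDisj_init`, **`prod_labels_eq`** (`Π_{X ∈ t.consts + t.groups} Π_{j∈X.lab} c_j =
  Π_{j∈K} c_j` for the terms of `expand 0 K`).
HONEST SCOPE: bookkeeping only; no `Ineq312` binder.  NOT summit progress; NOT continuum; NOT Clay.  Imports
`BIJ88WalkResummation312`, `BIJ88WalkActivityShape312`; modifies nothing.
-/

noncomputable section

namespace Literature.MathematicalPhysics.QuantumFieldTheory.BalabanImbrieJaffe1984to88.BIJ88WalkLabelPartition312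

open Classical Matrix Finset
open scoped BigOperators
open BIJ88LabelledRun311 (mbind mem_mbind)
open BIJ88WalkRun311 BIJ88WalkRunEnv311 BIJ88WalkExpansion311 BIJ88WalkWeights312 BIJ88WalkActivityShape312
  BIJ88WalkResummation312

variable {S : Type} [Fintype S] {ι : Type} [Fintype ι] {κ : Type} [LinearOrder κ] {P : Type} [Fintype P]

variable {Cov : P → Matrix S S ℝ} {trig : P → Bool} {f : S → ℝ} {c : ι → ℝ} {legs : ι → List (S → ℝ)}
  {obs : κ → List (S → ℝ)} {M : ℕ}

/-- Membership in a union over a multiset (bookkeeping). [folklore] -/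
private theorem mem_msup {β : Type} [DecidableEq β] {m : Multiset (Finset β)} {x : β} :
    x ∈ m.sup ↔ ∃ v ∈ m, x ∈ v := by
  induction m using Multiset.induction_on with
  | empty => simp
  | cons a m ih => simp [Multiset.sup_cons, ih, or_and_right, exists_or]

omit [Fintype S] [Fintype ι] [LinearOrder κ] [Fintype P] in
/-- After a run from a consistent environment, the outcome's component set aside with the outcome's environment is
again consistent (bookkeeping from `LabDisj`). [cite: BalabanImbrieJaffe1988, §5.14 p.311] -/
private theorem envOK_cons' {o : WOut S κ ι P} (hL : LabDisj o.g o.rest o.done) (hT : Tidy obs legs o.g)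
    (hTd : ∀ h ∈ o.done, Tidy obs legs h) : EnvOK obs legs o.rest (o.g ::ₘ o.done) := by
  refine ⟨fun h hh => ?_, fun h₁ hh₁ h₂ hh₂ => ?_, fun h hh => ?_⟩
  · rcases Multiset.mem_cons.1 hh with rfl | hh
    · exact hL.1
    · exact (hL.2.1 h hh).2
  · rcases Multiset.mem_cons.1 hh₁ with rfl | hh₁
    · rw [Multiset.erase_cons_head] at hh₂
      exact (hL.2.1 h₂ hh₂).1
    · rw [Multiset.erase_cons_tail_of_mem hh₁] at hh₂
      rcases Multiset.mem_cons.1 hh₂ with rfl | hh₂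
      · exact (hL.2.1 h₁ hh₁).1.symm
      · exact hL.2.2 h₁ hh₁ h₂ hh₂
  · rcases Multiset.mem_cons.1 hh with rfl | hh
    · exact hT
    · exact hTd h hh

/-- **THE LABEL SETS OF THE BLOCKS AND OF THE COMPONENTS SET ASIDE ARE PAIRWISE DISJOINT** along the expansion from a
consistent environment. [cite: BalabanImbrieJaffe1988, §5.14 p.311–312] -/
theorem expand_labDisj : ∀ (n : ℕ) (done : Multiset (WGrp S κ ι P)) (rest : Finset κ), rest.card < n →
    EnvOK obs legs rest done → ∀ t ∈ expand Cov trig f c legs obs M done rest,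
      ∀ X ∈ t.consts + t.groups, ∀ Y ∈ (t.consts + t.groups).erase X, Disjoint X.lab Y.lab
  | 0, _, _, hn => fun _ _ _ => absurd hn (Nat.not_lt_zero _)
  | n + 1, done, rest, hn => by
    intro hE t ht
    by_cases h : rest.Nonempty
    · rw [expand_of_nonempty Cov trig f c legs obs M h, mem_mbind] at ht
      obtain ⟨o, ho, ht⟩ := ht
      have hcard : o.rest.card < n := lt_of_lt_of_le (lt_of_le_of_lt (Finset.card_le_card (run_rest_subset _ _ _ o ho))
        (Finset.card_erase_lt_of_mem (rest.min'_mem h))) (Nat.lt_succ_iff.1 hn)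
      have hL0 : LabDisj (pristine (ι := ι) (P := P) obs (rest.min' h)) (rest.erase (rest.min' h)) done :=
        labDisj_pristine hE.1 hE.2.1 (rest.min'_mem h)
      have hL := run_labDisj _ _ _ o ho hL0
      obtain ⟨hTg, hTd⟩ := run_tidy _ _ _ o ho hL0 (tidy_pristine (rest.min' h)) hE.2.2
      split_ifs at ht with hg
      · rw [Multiset.mem_map] at ht
        obtain ⟨t', ht', rfl⟩ := ht
        have hE' : EnvOK obs legs o.rest o.done := ⟨fun h hh => (hL.2.1 h hh).2, hL.2.2, hTd⟩
        have IH := expand_labDisj n o.done o.rest hcard hE' t' ht'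
        -- the new block is disjoint from every later component (their labels come from `o.done` and `o.rest`)
        have hlab := expand_lab (Cov := Cov) (trig := trig) (f := f) (c := c) (legs := legs) (obs := obs) (M := M)
          _ o.done o.rest (Nat.lt_succ_self _) t' ht'
        have hnew : ∀ Y ∈ t'.consts + t'.groups, Disjoint o.g.lab Y.lab := by
          intro Y hY
          have hsub : Y.lab ≤ ((t'.consts + t'.groups).map WGrp.lab).sup := Multiset.le_sup (Multiset.mem_map_of_mem _ hY)
          rw [hlab] at hsub
          refine Finset.disjoint_left.2 fun x hx hxY => ?_
          rcases Finset.mem_union.1 (hsub hxY) with hx' | hx'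
          · obtain ⟨v, hv, hxv⟩ := mem_msup.1 hx'
            obtain ⟨h', hh', rfl⟩ := Multiset.mem_map.1 hv
            exact Finset.disjoint_left.1 (hL.2.1 h' hh').1 hx hxv
          · exact Finset.disjoint_left.1 hL.1 hx hx'
        have e : ((oact o t').addConst o.g).consts + ((oact o t').addConst o.g).groups
            = o.g ::ₘ (t'.consts + t'.groups) := by
          simp only [WTerm.addConst_consts, WTerm.addConst_groups, oact_consts, oact_groups, Multiset.cons_add]
        rw [e]
        intro X hX Y hY
        rcases Multiset.mem_cons.1 hX with rfl | hX
        · rw [Multiset.erase_cons_head] at hY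
          exact hnew Y hY
        · rw [Multiset.erase_cons_tail_of_mem hX] at hY
          rcases Multiset.mem_cons.1 hY with rfl | hY
          · exact (hnew X hX).symm
          · exact IH X hX Y hY
      · rw [Multiset.mem_map] at ht
        obtain ⟨t', ht', rfl⟩ := ht
        have IH := expand_labDisj n _ o.rest hcard (envOK_cons' hL hTg hTd) t' ht'
        simpa only [oact_consts, oact_groups] using IH
    · rw [expand_of_not_nonempty Cov trig f c legs obs M h, Multiset.mem_singleton] at ht
      subst ht
      intro X hX Y hY
      rw [zero_add] at hX hY
      exact hE.2.1 X hX Y hY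

/-- **… for the expansion of a product of observables** (nothing set aside). [cite: BalabanImbrieJaffe1988, §5.14 p.312] -/
theorem expand_labDisj_init (K : Finset κ) :
    ∀ t ∈ expand Cov trig f c legs obs M 0 K,
      ∀ X ∈ t.consts + t.groups, ∀ Y ∈ (t.consts + t.groups).erase X, Disjoint X.lab Y.lab :=
  expand_labDisj (Cov := Cov) (trig := trig) (f := f) (c := c) _ 0 K (Nat.lt_succ_self _) (envOK_zero K)

omit [Fintype S] [Fintype ι] [LinearOrder κ] [Fintype P] in
/-- A product over pairwise disjoint label sets is the product over their union (bookkeeping). [folklore] -/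
private theorem prod_prod_eq_prod_sup [DecidableEq κ] (cj : κ → ℝ) :
    ∀ m : Multiset (WGrp S κ ι P), (∀ X ∈ m, ∀ Y ∈ m.erase X, Disjoint X.lab Y.lab) →
      (m.map fun X => ∏ j ∈ X.lab, cj j).prod = ∏ j ∈ (m.map WGrp.lab).sup, cj j := by
  intro m
  induction m using Multiset.induction_on with
  | empty => intro; simp
  | cons g m ih =>
    intro hd
    have hdm : ∀ X ∈ m, ∀ Y ∈ m.erase X, Disjoint X.lab Y.lab := fun X hX Y hY =>
      hd X (Multiset.mem_cons_of_mem hX) Y (by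
        rw [Multiset.erase_cons_tail_of_mem hX]; exact Multiset.mem_cons_of_mem hY)
    have hg : Disjoint g.lab (m.map WGrp.lab).sup := by
      refine Finset.disjoint_left.2 fun x hx hx' => ?_
      obtain ⟨v, hv, hxv⟩ := mem_msup.1 hx'
      obtain ⟨Y, hY, rfl⟩ := Multiset.mem_map.1 hv
      exact Finset.disjoint_left.1 (hd g (Multiset.mem_cons_self _ _) Y (by rwa [Multiset.erase_cons_head])) hx hxv
    rw [Multiset.map_cons, Multiset.prod_cons, ih hdm, Multiset.map_cons, Multiset.sup_cons, Finset.sup_eq_union,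
      Finset.prod_union hg]

/-- **THE LARGE CONSTANTS COLLECT PER OBSERVABLE**: for every term of the expansion of the product of the
observables `K`, `Π_{X ∈ t.consts + t.groups} Π_{j ∈ X.lab} c_j = Π_{j ∈ K} c_j` — each observable sits in exactly
one block or remainder component. [cite: BalabanImbrieJaffe1988, §5.14 p.312] -/
theorem prod_labels_eq (cj : κ → ℝ) (K : Finset κ) :
    ∀ t ∈ expand Cov trig f c legs obs M 0 K,
      ((t.consts + t.groups).map fun X => ∏ j ∈ X.lab, cj j).prod = ∏ j ∈ K, cj j := by
  intro t ht
  rw [prod_prod_eq_prod_sup cj _ (expand_labDisj_init (Cov := Cov) (trig := trig) (f := f) (c := c) K t ht),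
    expand_lab (Cov := Cov) (trig := trig) (f := f) (c := c) (legs := legs) (obs := obs) (M := M) _ 0 K
      (Nat.lt_succ_self _) t ht]
  simp

end Literature.MathematicalPhysics.QuantumFieldTheory.BalabanImbrieJaffe1984to88.BIJ88WalkLabelPartition312

end
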